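import Summits.CriticalPhenomena.PercolationContinuityZ3.Theorems.PercNearOneGluingNoHeavyQuantGatedSliceMixLawRegimeBCells
import Summits.CriticalPhenomena.PercolationContinuityZ3.Theorems.PercNearOneGluingNoHeavyQuantGatedSliceMixLawRegimeBStar
import HarnessLib

/-!
# QUANT lane R8, T-DEC, leg (III), blob case — the regime-B cell `LawDec.MixLawCellBG` of `GatedSliceMixLaw'` IS A THEOREM

builds on p205010 (kernel theorem, internal audit signed; external expert review pending)

Support file (`--supports stmt-CriticalPhenomena-4575`), QUANT lane seat prim-quant-arm-2 (gen 36), rung R8 of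
`run/shared/lean/prim/quant/LADDER.md`.  One theorem, standard axioms, no sorries, no definitions.

`LawDec.MixLawCellBG` (census-2 g61, `…QuantGatedSliceMixLawRegimeBCells`) is the binder of `LawDec.MixLawRegimeB` with the shifted low
`ℓ = k₁ + a` a `t`-low and the top `k₂` a giant — the first antecedent of census-2's `mixLawRegimeB_of_cells`
(`…QuantGatedSliceMixLawRegimeBOfCells`).  It is discharged VERBATIM by `LawDec.mixLawRegimeB_of_cellBG` (`…QuantGatedSliceMixLawRegimeBStar`,
this seat: the second kink `gatedSliceMixLaw_regimeB_kink2` of lead g32, else the first kink with the inequality (⋆) proved on the residue).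
An independent closure of the same cell is lead g32's `gatedSliceMixLaw_regimeBG` (`…QuantGatedSliceMixLawRegimeBG`).

* **`LawDec.mixLawCellBG_holds : MixLawCellBG`**.

HONEST STATUS: `MixLawRegimeB` still needs `MixLawCellBTwin`, `MixLawCellQ4`, `MixLawCellPDear`, `MixLawCellPCheap`, `MixLawCellBTopBelow`
(census-2 g61's case tree); `GatedSliceMixLaw'`, CW, `SingleGateConvClosed`, `TreeDEC`, `FarTreeRow` OPEN; RATE class log* / honest sentence unchanged.

[this work]; cell map: census-2 g61, lead g32.  Nothing here is cited as a published result.  The gluing rows served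
[cite: KozmaNitzan2024, Conjecture 3 (p. 15)]; product measure [cite: Grimmett1999, §1.3 p. 10].
-/

noncomputable section

namespace Summit.CriticalPhenomena.PercolationContinuityZ3.Theorems

namespace Quant

namespace LawDec

/-- **CELL B-G OF `MixLawRegimeB` HOLDS**: the `@[conjecture]` binder `MixLawCellBG` is exactly the statement of
`mixLawRegimeB_of_cellBG`. [this work] -/
theorem mixLawCellBG_holds : MixLawCellBG :=
  fun y z g S lam a j M h k₁ k₂ hy0 hy1 hz0 hz1 hg1 hyg ha1 hjM hS0 hta hhj hhM hSh hW hk hk₂M hlam0 hlam1 hmean hk₁j hk₁low hdj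
      hk₂aG htS hhaG hdlow hk₂G =>
    mixLawRegimeB_of_cellBG y z g S lam a j M h k₁ k₂ hy0 hy1 hz0 hz1 hg1 hyg ha1 hjM hS0 hta hhj hhM hSh hW hk hk₂M hlam0 hlam1 hmean
      hk₁j hk₁low hdj hk₂aG htS hhaG hdlow hk₂G

end LawDec

end Quant

end Summit.CriticalPhenomena.PercolationContinuityZ3.Theorems
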